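import Summits.SmoothPoincare4.SmoothPoincare4.Theses.VerlindeRLinks
import Summits.SmoothPoincare4.SmoothPoincare4.Theorems.VrlSlideGap.Negative.BirthLineVersusSliceRigidity
import Literature.Topology.FourManifolds.LinkingNumberPushOffInstance
import Literature.Topology.FourManifolds.KirbyCalculusUnlinkProofs
import Literature.Topology.FourManifolds.KirbyMovesProofs
import Literature.Topology.FourManifolds.KirbyCalculusStrict
import Literature.Topology.FourManifolds.DehnSurgeryProofs
import HarnessLib.Audit

/-!
# Disproof of `VrlSlideGap` (stmt-SmoothPoincare4-16178) — findings

Standing disprover work file for the crux `Summit.SmoothPoincare4.SmoothPoincare4.Theses.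
VerlindeRLinks.VrlSlideGap` (route VerlindeRLinks, rank 2). Cycle 1 (2026-08-17,
refuter-cdisprove-stmt-SmoothPoincare4-16178-0). Everything below is kernel-checked unless it
sits in a docstring; there is NO `sorry` in this file.

## Verdict of cycle 1: NO KILL — the crux is an open problem pointing the "believed" way

* §0 `vrlSlideGap_iff_not_strictGPRC`: the crux is, up to the proved Prop-instance
  `Knot.TubularNbhd.smoothnessFacts`, EXACTLY `¬ StrictGeneralizedPropertyRConjecture`
  (printed Generalised Property R, Kirby Problem 1.82 / GST 2010 Conj. 1). A disproof of the crux
  is a PROOF of printed GPRC for every `n`; experts expect GPRC to be FALSE (GST 2010 §1 "probably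
  false"; LOSZ arXiv:2603.05664 §1, DPY arXiv:2604.17737 §1, 2026: status unchanged), i.e. the
  crux to be TRUE. No junk in the interface makes it cheaply decidable either way (§6).
* Consequence drawn for provers: do not expect help from this seat in the form `¬ crux`; the
  usable output is (i) WHERE witnesses cannot live (§2, §5), (ii) WHICH conjuncts any proof must
  use (§1), (iii) which strengthenings are already false (§3), (iv) what the picked line's
  skeleton shape does and does not carry (§4).

## Index

* §0 precision: `vrlSlideGap_iff_not_strictGPRC`, `not_vrlSlideGap_of_strictGPRC` (sector).
* §1 LOAD-BEARING ANALYSIS (dual form for an `∃`-crux: dropping a conjunct makes the statement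
  TRIVIALLY TRUE, so any proof must USE that conjunct):
  `VrlSlideGapWithoutRLink` / `_holds` (drop both surgery conjuncts: witness `(unknot, 1)`),
  `VrlSlideGapWithoutSurgeryLink` / `_holds` (keep `Y ≅ #ⁿ S²×S¹`, drop `L.IsSurgery Y`: same
  witness, `Y` borrowed from the `0`-framed unknot), `VrlSlideGapWithoutSphereSum` / `_holds_of`
  (keep `L.IsSurgery Y`, drop `Y ≅ #ⁿ S²×S¹`: `(unknot, 1)` with `Y = S³`, modulo the print fact
  `isIntegralSurgery_unknot_of_natAbs_eq_one`), `VrlSlideGapWithoutNoSlideClause` / `_holds`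
  (drop the no-slide clause: the empty link). Moral: the binding of `L` to `Y` through BOTH
  surgery conjuncts and the no-slide clause are each load-bearing; nothing else is.
* §2 SMALL COMPONENT COUNTS: `no_witness_zero`, `witness_pos` (n = 0 excluded outright);
  `framingAtOne`, `framing_eq_of_equiv_one` (strict slide equivalence of framed KNOTS preserves
  the framing — there is no strict slide in `Fin 1`); `PropertyROne` (Gabai + H₁, in print) and
  `two_le_of_witness` (modulo `PropertyROne` every witness has `n ≥ 2`).
* §3 NATURAL STRENGTHENINGS REFUTED: `not_forall_rlink_gap` ("every R-link with n ≥ 1 resists"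
  is false: the `0`-framed unknot), `vrlSlideGap_false_with_kirbyMoves_of` (replace strict slides
  by strict Kirby moves, i.e. admit blow-ups: FALSE modulo Kirby's theorem + uniqueness of
  `#ⁿ S²×S¹` + two elementary unlink facts — the exclusion of blow-ups is THE load-bearing
  feature of the conclusion's relation).
* §4 LINE `Sketch` (= idea `slide-coinvariants`, PICKED 2026-08-17T11:40Z):
  `invariantShape_iff_vrlSlideGap` — "∃ an invariant of strict slides separating some R-link from
  every `0`-framed unlink" is logically THE CRUX (both directions proved). The skeleton
  `certificate_gives_crux_shape M J N` therefore carries content only through NAMED `(H, Q_n(H),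
  J)`; see the docstring for what this means for stubs K1–K3 and for the K1 criterion.
* §4b `SketchCopy.sketchShape_iff_vrlSlideGap` — against VERBATIM copies of the lead's
  `Lines/Sketch.lean` shapes: `(∃ M N J, Functorial N J ∧ Certificate N J) ↔ VrlSlideGap`; plus
  the lead's K1-lite result (coarse `u_q(sl₂)` receptacle = `span{ε⊗ε, χ⊗χ}`, p = 3, 5, 7),
  which is exactly the plane §4 predicts for every finite-dimensional Hopf algebra.
* §5 witness-pool constraints from print (docblock): framings 0, lk 0 (GST Prop. 2.2), no
  unknotted component at `n = 2` (GST Prop. 3.2), tunnel number `> 1` at `n = 2` (Reid, GST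
  Prop. 3.1), no least-genus fibred component at `n = 2` (GST Thm 3.3), components H-ball slice
  (Hillman, GST Prop. 2.3 = route item VrlComponentsHBallSlice).
* §6 why no junk refutation exists (docblock): audit of `IsSurgery`, `IsSphereTwoProdCircleSum`,
  `IsStrictHandleSlide`, `Link.IsIsotopic`, `HasLinkingNumber`.
* Sibling interaction (imported, p150066): `Theorems/VrlSlideGap/Negative/
  BirthLineVersusSliceRigidity.lean` — the registered birth line's heart stub
  `AKPresentationsACNontrivial` refutes the sibling crux `VrlSliceRigidity`.

## Targets
`payload.stuck_stubs = []` at arming; the lead's PICKED line is `Sketch` (slide-coinvariants),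
whose stubs K1 (receptacle non-collapse), K2 (certificate), K3 (functoriality over the tree) are
computations / a definition request, not tree signatures yet. §4 is what Lean can say today.
-/

noncomputable section

set_option linter.dupNamespace false

namespace Summit.SmoothPoincare4.SmoothPoincare4.Cruxes.VrlSlideGap.Disproof

open scoped Manifold ContDiff Topology
open Function Set
open Literature.Topology.FourManifolds
open Summit.SmoothPoincare4.SmoothPoincare4.Theses.VerlindeRLinks (VrlSlideGap VrlSliceRigidity)

/-- Local notation: `𝔼 n` is the model Euclidean space `EuclideanSpace ℝ (Fin n)`. -/
local notation "𝔼 " n:arg => EuclideanSpace ℝ (Fin n)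

/-- Local notation: `𝕊 n` is the unit sphere in `EuclideanSpace ℝ (Fin (n + 1))`. -/
local notation "𝕊 " n:arg => (Metric.sphere (0 : EuclideanSpace ℝ (Fin (n + 1))) 1)

/-! ## §0 Precision: the crux is the negation of printed GPRC -/

/-- **The crux is exactly `¬` printed Generalised Property R.** The leading
`∃ (_ : Knot.TubularNbhd.SmoothnessFacts)` of the crux is discharged by the tree's proved
instance `Knot.TubularNbhd.smoothnessFacts` (proof-irrelevant), and the rest is verbatim the
negation of `StrictGeneralizedPropertyRConjecture` (`PropertyRStrict.lean`). Hence a DISPROOF of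
the crux is a PROOF of printed GPRC for all `n` (Kirby 1.82; GST 2010 Conj. 1), open and
believed false by its proposers. [cite: GompfScharlemannThompson2010, §2 Conjecture 1] -/
theorem vrlSlideGap_iff_not_strictGPRC :
    VrlSlideGap ↔ ¬ StrictGeneralizedPropertyRConjecture := by
  constructor
  · intro hg h
    obtain ⟨inst, n, L, Y, i1, i2, i3, i4, i5, i6, i7, hY, hL, hgap⟩ := hg
    obtain ⟨U, hU, hLU⟩ := h n L Y hY hL
    exact hgap U hU hLU
  · intro h
    by_contra hc
    apply h
    intro n L Y _ _ _ _ _ _ _ hY hL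
    by_contra hno
    push Not at hno
    exact hc ⟨inferInstance, n, L, Y, ‹_›, ‹_›, ‹_›, ‹_›, ‹_›, ‹_›, ‹_›, hY, hL,
      fun U hU hLU => hno U hU hLU⟩

/-- **Sector lemma** (`H → ¬ crux` with `H` an OPEN CONJECTURE, recorded for orientation only —
this is NOT a negative lemma modulo a constructible object, and printed GPRC is expected to be
false): printed Generalised Property R refutes the crux. [cite: GompfScharlemannThompson2010, §2 Conjecture 1] -/
theorem not_vrlSlideGap_of_strictGPRC (h : StrictGeneralizedPropertyRConjecture) : ¬ VrlSlideGap :=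
  fun hg ↦ (vrlSlideGap_iff_not_strictGPRC.1 hg) h

/-! ## §2 (first part) The component count: `n = 0` and the `n = 1` framing invariant

(Placed before §1 because the load-bearing analysis uses the `n = 1` invariant.) -/

/-- At `n = 0` there is no witness: the empty framed link is its own `0`-framed unlink
(`FramedLink.isZeroFramedUnlink_of_isEmpty`) and strict slide equivalence is reflexive; the two
surgery hypotheses are not even needed. [folklore] -/
theorem no_witness_zero (L : FramedLink (Fin 0)) :
    ∃ U : FramedLink (Fin 0), U.IsZeroFramedUnlink ∧ IsStrictHandleSlideEquivalent ⟨0, L⟩ ⟨0, U⟩ :=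
  ⟨L, L.isZeroFramedUnlink_of_isEmpty, Relation.EqvGen.refl _⟩

/-- Hence every witness of the crux has `0 < n`. [folklore] -/
theorem witness_pos {n : ℕ} (L : FramedLink (Fin n))
    (hgap : ∀ U : FramedLink (Fin n), U.IsZeroFramedUnlink →
      ¬ IsStrictHandleSlideEquivalent ⟨n, L⟩ ⟨n, U⟩) : 0 < n := by
  rcases n with _ | n
  · obtain ⟨U, hU, hLU⟩ := no_witness_zero L
    exact absurd hLU (hgap U hU)
  · exact Nat.succ_pos n

/-- The `n = 1` invariant: the framing of a one-component framed link, `none` otherwise. -/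
def framingAtOne : FramedLinkFin → Option ℤ
  | ⟨1, L⟩ => some (L.framing 0)
  | _ => none

/-- `framingAtOne` on a one-component framed link (unfolding). [folklore] -/
@[simp] theorem framingAtOne_one (L : FramedLink (Fin 1)) :
    framingAtOne ⟨1, L⟩ = some (L.framing 0) := rfl

/-- **A strict handle-slide MOVE preserves `framingAtOne`.** Isotopy keeps the framing function,
renumbering of `Fin 1` is the identity, reversal keeps framings, and a strict slide needs two
distinct components `i ≠ j`, impossible in `Fin 1`; for `n ≠ 1` both sides are `none`. So at
`n = 1` the move calculus has NO slide content at all. [folklore] -/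
theorem framingAtOne_eq_of_move {L L' : FramedLinkFin} (h : StrictHandleSlideMove L L') :
    framingAtOne L = framingAtOne L' := by
  cases h with
  | @isotopy n L L' h =>
    obtain ⟨-, hf⟩ := h
    rcases n with _ | _ | n
    · rfl
    · simp [hf]
    · rfl
  | @reindex n e L =>
    rcases n with _ | _ | n
    · rfl
    · show some (L.framing 0) = some (L.framing (e 0))
      rw [Subsingleton.elim (α := Fin 1) (e 0) 0]
    · rfl
  | @reverseComponent n i L =>
    rcases n with _ | _ | n
    · rfl
    · simp
    · rfl
  | @handleSlide n L L' h =>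
    rcases n with _ | _ | n
    · rfl
    · obtain ⟨i, j, hij, -⟩ := h
      exact absurd (Subsingleton.elim (α := Fin 1) i j) hij
    · rfl

/-- **The invariant principle**: a function of framed links that is constant along every strict
handle-slide MOVE is constant on strict handle-slide CLASSES (`Relation.EqvGen` induction). This
is all the "functoriality ⇒ invariance" glue any certificate line needs. [folklore] -/
theorem invariant_of_equiv {M : Sort*} (σ : FramedLinkFin → M)
    (hσ : ∀ L L' : FramedLinkFin, StrictHandleSlideMove L L' → σ L = σ L')
    {L L' : FramedLinkFin} (h : IsStrictHandleSlideEquivalent L L') : σ L = σ L' := by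
  unfold IsStrictHandleSlideEquivalent at h
  induction h with
  | rel _ _ h => exact hσ _ _ h
  | refl => rfl
  | symm _ _ _ ih => exact ih.symm
  | trans _ _ _ _ _ ih₁ ih₂ => exact ih₁.trans ih₂

/-- `framingAtOne` is invariant under strict handle-slide EQUIVALENCE. [folklore] -/
theorem framingAtOne_eq_of_equiv {L L' : FramedLinkFin} (h : IsStrictHandleSlideEquivalent L L') :
    framingAtOne L = framingAtOne L' :=
  invariant_of_equiv framingAtOne (fun _ _ h ↦ framingAtOne_eq_of_move h) h

/-- **Strict slide equivalence of framed KNOTS preserves the framing.** In particular the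
no-slide clause of the crux holds at `n = 1` for EVERY framed knot `(K, m)` with `m ≠ 0`
(against every `0`-framed unlink), with no slide content whatsoever; a crux witness at `n = 1`
is excluded only by the surgery conjuncts (Gabai's Property R, `two_le_of_witness`). [folklore] -/
theorem framing_eq_of_equiv_one {L L' : FramedLink (Fin 1)}
    (h : IsStrictHandleSlideEquivalent ⟨1, L⟩ ⟨1, L'⟩) : L.framing 0 = L'.framing 0 := by
  simpa using framingAtOne_eq_of_equiv h

/-- The framed knot `(K, m)`, `m ≠ 0`, is strictly slide-equivalent to NO `0`-framed unlink. [folklore] -/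
theorem single_not_equiv_unlink (K : Knot) {m : ℤ} (hm : m ≠ 0) (U : FramedLink (Fin 1))
    (hU : U.IsZeroFramedUnlink) :
    ¬ IsStrictHandleSlideEquivalent ⟨1, FramedLink.single K m⟩ ⟨1, U⟩ := by
  intro h
  have h1 := framing_eq_of_equiv_one h
  rw [FramedLink.single_framing, hU.2 0] at h1
  exact hm h1

/-- The `0`-framed unknot, as a one-component framed link, is a `0`-framed unlink: the unknot
bounds the standard smoothly embedded disc `unknotDisc` (`isSmoothDisc_unknotDisc_holds`,
proved in the tree). [folklore] -/
theorem isZeroFramedUnlink_single_unknot_zero :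
    (FramedLink.single unknot 0).IsZeroFramedUnlink :=
  ⟨⟨fun _ ↦ unknotDisc, fun _ ↦ ⟨isSmoothDisc_unknotDisc_holds, fun x ↦ by simp⟩,
    Subsingleton.pairwise⟩, fun _ ↦ rfl⟩

/-- The `0`-framed unknot is an R-link with `n = 1`: its surgery exists as a closed connected
smooth 3-manifold `Y ≅ S³ # (S² × S¹)` (tree theorem `exists_isSurgery_zeroFramedUnlink_holds`).
[cite: GompfStipsicz1999, §5.3] -/
theorem exists_rlink_one :
    ∃ (Y : Type) (_ : TopologicalSpace Y) (_ : T2Space Y) (_ : SecondCountableTopology Y)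
      (_ : ChartedSpace (𝔼 3) Y) (_ : IsManifold (𝓡 3) ∞ Y) (_ : CompactSpace Y)
      (_ : ConnectedSpace Y),
      IsSphereTwoProdCircleSum 1 Y ∧ (FramedLink.single unknot 0).IsSurgery (𝓡 3) Y :=
  exists_isSurgery_zeroFramedUnlink_holds _ isZeroFramedUnlink_single_unknot_zero

/-! ## §1 Load-bearing analysis of the `∃`-crux

For a universally quantified crux one drops a hypothesis and refutes the stronger statement.
The crux here is EXISTENTIAL: its "hypotheses" are the conjuncts constraining the witness, and
dropping one makes the statement WEAKER. The informative dual is: the weakened statement is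
TRIVIALLY TRUE (by a witness having nothing to do with Property R), so any proof of the crux that
does not use the dropped conjunct proves nothing. All four variants below keep the crux's binder
list verbatim and delete exactly one piece. -/

/-- The crux with BOTH surgery conjuncts deleted (and the then idle manifold binders dropped):
"some framed link is strictly slide-equivalent to no `0`-framed unlink". -/
def VrlSlideGapWithoutRLink : Prop :=
  ∃ (_ : Knot.TubularNbhd.SmoothnessFacts) (n : ℕ) (L : FramedLink (Fin n)),
    ∀ U : FramedLink (Fin n), U.IsZeroFramedUnlink → ¬ IsStrictHandleSlideEquivalent ⟨n, L⟩ ⟨n, U⟩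

/-- **Trivially true without the R-link hypothesis**: the `(+1)`-framed unknot resists every
slide to a `0`-framed unlink for the silly reason that framed knots admit no slides and keep
their framing (`single_not_equiv_unlink`). So the surgery conjuncts are load-bearing. [folklore] -/
theorem vrlSlideGapWithoutRLink_holds : VrlSlideGapWithoutRLink :=
  ⟨inferInstance, 1, FramedLink.single unknot 1, single_not_equiv_unlink unknot one_ne_zero⟩

/-- The crux with ONLY the conjunct `L.IsSurgery (𝓡 3) Y` deleted (all binders kept): some
framed link `L` and some `Y ≅ #ⁿ (S² × S¹)`, unrelated to each other, with `L` sliding to no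
`0`-framed unlink. -/
def VrlSlideGapWithoutSurgeryLink : Prop :=
  ∃ (_ : Knot.TubularNbhd.SmoothnessFacts) (n : ℕ) (L : FramedLink (Fin n)) (Y : Type)
    (_ : TopologicalSpace Y) (_ : T2Space Y) (_ : SecondCountableTopology Y)
    (_ : ChartedSpace (𝔼 3) Y) (_ : IsManifold (𝓡 3) ∞ Y) (_ : CompactSpace Y)
    (_ : ConnectedSpace Y),
    IsSphereTwoProdCircleSum n Y ∧
      ∀ U : FramedLink (Fin n), U.IsZeroFramedUnlink → ¬ IsStrictHandleSlideEquivalent ⟨n, L⟩ ⟨n, U⟩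

/-- **Trivially true without `L.IsSurgery Y`** (outright): take `n = 1`, `L = (unknot, 1)` and
borrow `Y ≅ S³ # (S² × S¹)` from the `0`-framed unknot (`exists_rlink_one`). So the conjunct
tying `L` to `Y` is load-bearing, not merely the existence of a `#ⁿ (S² × S¹)`. [folklore] -/
theorem vrlSlideGapWithoutSurgeryLink_holds : VrlSlideGapWithoutSurgeryLink := by
  obtain ⟨Y, i1, i2, i3, i4, i5, i6, i7, hY, -⟩ := exists_rlink_one
  exact ⟨inferInstance, 1, FramedLink.single unknot 1, Y, i1, i2, i3, i4, i5, i6, i7, hY,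
    single_not_equiv_unlink unknot one_ne_zero⟩

/-- The crux with ONLY the conjunct `IsSphereTwoProdCircleSum n Y` deleted (all binders kept):
some framed link whose surgery is SOME closed connected 3-manifold slides to no `0`-framed
unlink. -/
def VrlSlideGapWithoutSphereSum : Prop :=
  ∃ (_ : Knot.TubularNbhd.SmoothnessFacts) (n : ℕ) (L : FramedLink (Fin n)) (Y : Type)
    (_ : TopologicalSpace Y) (_ : T2Space Y) (_ : SecondCountableTopology Y)
    (_ : ChartedSpace (𝔼 3) Y) (_ : IsManifold (𝓡 3) ∞ Y) (_ : CompactSpace Y)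
    (_ : ConnectedSpace Y),
    L.IsSurgery (𝓡 3) Y ∧
      ∀ U : FramedLink (Fin n), U.IsZeroFramedUnlink → ¬ IsStrictHandleSlideEquivalent ⟨n, L⟩ ⟨n, U⟩

/-- The one-component framed link `(K, m)` is the reindexing along `Fin 1 ≃ Unit` of the framed
link on `Link.ofKnot K` with framing `m` (definitional). [folklore] -/
theorem single_eq_reindex (K : Knot) (m : ℤ) :
    FramedLink.single K m =
      (⟨Link.ofKnot K, fun _ ↦ m⟩ : FramedLink Unit).reindex (Equiv.equivPUnit (Fin 1)).symm.symm := by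
  rfl

/-- **Trivially true without `Y ≅ #ⁿ (S² × S¹)`**, modulo the print fact
`isIntegralSurgery_unknot_of_natAbs_eq_one` (`+1`-surgery on the unknot is `S³`; Rolfsen §9.G
Ex. 4, named fact of `DehnSurgery.lean`, not yet discharged in the tree): `L = (unknot, 1)`,
`Y = S³`. So it is the IDENTIFICATION of the surgery as `#ⁿ (S² × S¹)` that is load-bearing,
not the existence of a surgery. [cite: Rolfsen1976, §9.G Example 4] -/
theorem vrlSlideGapWithoutSphereSum_holds_of (h1 : isIntegralSurgery_unknot_of_natAbs_eq_one) :
    VrlSlideGapWithoutSphereSum := by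
  haveI : ConnectedSpace (𝕊 3) := connectedSpace_sphere_succ 2
  have hK : IsIntegralSurgery (𝓡 3) (𝕊 3) unknot 1 := h1 1 rfl
  have hL : (FramedLink.single unknot 1).IsSurgery (𝓡 3) (𝕊 3) := by
    rw [single_eq_reindex]
    exact FramedLink.IsSurgery.reindex (L := (⟨Link.ofKnot unknot, fun _ ↦ (1 : ℤ)⟩ : FramedLink Unit))
      hK.isIntegralSurgeryLink' _
  exact ⟨inferInstance, 1, FramedLink.single unknot 1, 𝕊 3, inferInstance, inferInstance,
    inferInstance, inferInstance, inferInstance, inferInstance, inferInstance, hL,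
    single_not_equiv_unlink unknot one_ne_zero⟩

/-- The crux with ONLY the no-slide clause deleted (all binders kept): "an R-link exists". -/
def VrlSlideGapWithoutNoSlideClause : Prop :=
  ∃ (_ : Knot.TubularNbhd.SmoothnessFacts) (n : ℕ) (L : FramedLink (Fin n)) (Y : Type)
    (_ : TopologicalSpace Y) (_ : T2Space Y) (_ : SecondCountableTopology Y)
    (_ : ChartedSpace (𝔼 3) Y) (_ : IsManifold (𝓡 3) ∞ Y) (_ : CompactSpace Y)
    (_ : ConnectedSpace Y),
    IsSphereTwoProdCircleSum n Y ∧ L.IsSurgery (𝓡 3) Y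

/-- **Trivially true without the no-slide clause** (outright): R-links exist — already the empty
link with `Y = S³` (`exists_isSurgery_zeroFramedUnlink_holds` at `n = 0`), or the `0`-framed
unknot (`exists_rlink_one`). The data conjuncts of the crux are therefore INHABITED (the crux is
not vacuous) and the no-slide clause is load-bearing. [folklore] -/
theorem vrlSlideGapWithoutNoSlideClause_holds : VrlSlideGapWithoutNoSlideClause := by
  obtain ⟨Y, i1, i2, i3, i4, i5, i6, i7, hY, hL⟩ := exists_rlink_one
  exact ⟨inferInstance, 1, FramedLink.single unknot 0, Y, i1, i2, i3, i4, i5, i6, i7, hY, hL⟩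

/-! ## §2 (second part) Witnesses have at least two components, modulo Property R -/

/-- **Property R at the level of the crux's vocabulary** (`n = 1` slice of printed GPRC in
conclusion form): if integral surgery on a framed knot `(K, m)` is `S³ # (S² × S¹)` then `K` is
the unknot and `m = 0`. In print: `H₁(S³_m(K)) = ℤ/m` forces `m = 0` (GST 2010 Prop. 2.2), and
Gabai's Property R (J. Differential Geom. 26 (1987) Cor. 8.3; tree named fact
`isUnknot_of_isIntegralSurgery_zero` over the model `S² × S¹`) forces `K` = unknot; the passage
from `IsSphereTwoProdCircleSum 1 Y` to `Y ≅ S² × S¹` is uniqueness of connected sums. Stated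
here as ONE hypothesis so that `two_le_of_witness` isolates exactly what excludes `n = 1`.
[cite: GabaiJDG1987, Cor. 8.3] -/
def PropertyROne [Knot.TubularNbhd.SmoothnessFacts] : Prop :=
  ∀ (L : FramedLink (Fin 1)) (Y : Type) [TopologicalSpace Y] [T2Space Y]
    [SecondCountableTopology Y] [ChartedSpace (𝔼 3) Y] [IsManifold (𝓡 3) ∞ Y] [CompactSpace Y]
    [ConnectedSpace Y],
    IsSphereTwoProdCircleSum 1 Y → L.IsSurgery (𝓡 3) Y → (L.component 0).IsUnknot ∧ L.framing 0 = 0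

/-- A framed knot whose knot is the unknot (oriented ambient isotopy `F 1 ∘ K = unknot`) and
whose framing is `0` is strictly slide-equivalent to the `0`-framed unknot — by ONE isotopy
move. [folklore] -/
theorem equiv_single_unknot_of_isUnknot [Knot.TubularNbhd.SmoothnessFacts] (L : FramedLink (Fin 1))
    (hK : (L.component 0).IsUnknot) (hf : L.framing 0 = 0) :
    IsStrictHandleSlideEquivalent ⟨1, L⟩ ⟨1, FramedLink.single unknot 0⟩ := by
  obtain ⟨F, hF⟩ := hK
  refine Relation.EqvGen.rel _ _ (StrictHandleSlideMove.isotopy ⟨⟨F, fun i ↦ ?_⟩, ?_⟩)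
  · rw [Subsingleton.elim i 0]
    exact hF
  · funext i
    rw [Subsingleton.elim i 0, hf]
    rfl

/-- **Every witness of the crux has `n ≥ 2`, modulo Property R** (`PropertyROne`): `n = 0` is
`no_witness_zero`; at `n = 1` Property R makes the R-link the `0`-framed unknot up to isotopy,
which IS a `0`-framed unlink (`isZeroFramedUnlink_single_unknot_zero`). This is where the
witness search starts (GST 2010 §3: "almost nothing is known" beyond `n ≤ 1`).
[cite: GabaiJDG1987, Cor. 8.3] -/
theorem two_le_of_witness [Knot.TubularNbhd.SmoothnessFacts] (hR : PropertyROne) {n : ℕ}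
    (L : FramedLink (Fin n)) (Y : Type) [TopologicalSpace Y] [T2Space Y]
    [SecondCountableTopology Y] [ChartedSpace (𝔼 3) Y] [IsManifold (𝓡 3) ∞ Y] [CompactSpace Y]
    [ConnectedSpace Y] (hY : IsSphereTwoProdCircleSum n Y) (hL : L.IsSurgery (𝓡 3) Y)
    (hgap : ∀ U : FramedLink (Fin n), U.IsZeroFramedUnlink →
      ¬ IsStrictHandleSlideEquivalent ⟨n, L⟩ ⟨n, U⟩) : 2 ≤ n := by
  rcases n with _ | _ | n
  · exact absurd (witness_pos L hgap) (lt_irrefl 0)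
  · obtain ⟨hK, hf⟩ := hR L Y hY hL
    exact absurd (equiv_single_unknot_of_isUnknot L hK hf)
      (hgap _ isZeroFramedUnlink_single_unknot_zero)
  · omega

/-! ## §3 Natural strengthenings, refuted -/

/-- **"EVERY R-link with at least one component resists sliding" is false**: the `0`-framed
unknot is an R-link (`exists_rlink_one`) and is its own `0`-framed unlink. (The crux asks for
SOME R-link; the uniform strengthening dies on the calibration links, as it must.) [folklore] -/
theorem not_forall_rlink_gap :
    ¬ ∀ (n : ℕ) (L : FramedLink (Fin n)) (Y : Type) [TopologicalSpace Y] [T2Space Y]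
        [SecondCountableTopology Y] [ChartedSpace (𝔼 3) Y] [IsManifold (𝓡 3) ∞ Y] [CompactSpace Y]
        [ConnectedSpace Y], 0 < n → IsSphereTwoProdCircleSum n Y → L.IsSurgery (𝓡 3) Y →
        ∀ U : FramedLink (Fin n), U.IsZeroFramedUnlink →
          ¬ IsStrictHandleSlideEquivalent ⟨n, L⟩ ⟨n, U⟩ := by
  intro h
  obtain ⟨Y, i1, i2, i3, i4, i5, i6, i7, hY, hL⟩ := exists_rlink_one
  exact h 1 (FramedLink.single unknot 0) Y one_pos hY hL _ isZeroFramedUnlink_single_unknot_zero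
    (Relation.EqvGen.refl _)

/-- **Admitting blow-ups kills the crux** (modulo four results that are theorems in print):
replace `IsStrictHandleSlideEquivalent` (isotopy, renumbering, reversal, strict slides) by
`StrictKirbyEquivalent` (the same plus blow-ups/downs of split `±1`-unknots). Then every R-link
`L` IS equivalent to a `0`-framed unlink: its surgery `Y ≅ #ⁿ (S² × S¹)` is diffeomorphic to the
surgery on the `0`-framed `n`-unlink (uniqueness of `#ⁿ (S² × S¹)`, `hU`), so by Kirby's theorem
(`hK` = tree named fact `nonempty_diffeomorph_iff_strictKirbyEquivalent_or_mirror`, Kirby 1978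
Thm 1 / Gompf–Stipsicz Thm 5.3.6 in the unoriented form) `L` is strictly Kirby equivalent to the
unlink or to its mirror, and the mirror of a `0`-framed unlink is a `0`-framed unlink (`hM`);
`hE` supplies an `n`-component `0`-framed unlink for every `n`. So the EXCLUSION OF BLOW-UPS is
the load-bearing feature of the crux's conclusion: every certificate must be a strict-slide
invariant that is NOT a Kirby-move invariant (not a 3-manifold invariant).
[cite: Kirby1978, Thm 1; GompfStipsicz1999, Thm 5.3.6] -/
theorem vrlSlideGap_false_with_kirbyMoves_of
    (hK : nonempty_diffeomorph_iff_strictKirbyEquivalent_or_mirror.{0, 0})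
    (hU : ∀ (n : ℕ) (Y Y' : Type) [TopologicalSpace Y] [T2Space Y] [SecondCountableTopology Y]
      [ChartedSpace (𝔼 3) Y] [IsManifold (𝓡 3) ∞ Y] [CompactSpace Y] [ConnectedSpace Y]
      [TopologicalSpace Y'] [T2Space Y'] [SecondCountableTopology Y'] [ChartedSpace (𝔼 3) Y']
      [IsManifold (𝓡 3) ∞ Y'] [CompactSpace Y'] [ConnectedSpace Y'],
      IsSphereTwoProdCircleSum n Y → IsSphereTwoProdCircleSum n Y' → Nonempty (Y ≃ₘ⟮𝓡 3, 𝓡 3⟯ Y'))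
    (hE : ∀ n : ℕ, ∃ U : FramedLink (Fin n), U.IsZeroFramedUnlink)
    (hM : ∀ (n : ℕ) (U : FramedLink (Fin n)), U.IsZeroFramedUnlink → U.mirror.IsZeroFramedUnlink) :
    ¬ ∃ (_ : Knot.TubularNbhd.SmoothnessFacts) (n : ℕ) (L : FramedLink (Fin n)) (Y : Type)
        (_ : TopologicalSpace Y) (_ : T2Space Y) (_ : SecondCountableTopology Y)
        (_ : ChartedSpace (𝔼 3) Y) (_ : IsManifold (𝓡 3) ∞ Y) (_ : CompactSpace Y)
        (_ : ConnectedSpace Y),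
        IsSphereTwoProdCircleSum n Y ∧ L.IsSurgery (𝓡 3) Y ∧
          ∀ U : FramedLink (Fin n), U.IsZeroFramedUnlink → ¬ StrictKirbyEquivalent ⟨n, L⟩ ⟨n, U⟩ := by
  rintro ⟨inst, n, L, Y, _, _, _, _, _, _, _, hY, hL, hgap⟩
  obtain ⟨U, hUu⟩ := hE n
  obtain ⟨Y', _, _, _, _, _, _, _, hY', hU'⟩ := exists_isSurgery_zeroFramedUnlink_holds U hUu
  obtain ⟨e⟩ := hU n Y Y' hY hY'
  rcases (hK ⟨n, L⟩ ⟨n, U⟩ Y Y' hL hU').1 ⟨e⟩ with h | h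
  · exact hgap U hUu h
  · exact hgap U.mirror (hM n U hUu) h

/-! ## §4 Line `Sketch` (idea `slide-coinvariants`, PICKED): what the skeleton shape carries

The picked line's glue is `certificate_gives_crux_shape M J N : ReceptacleShape M J N →
CertificateShape M J N → VrlSlideGap` with `(M, J, N)` free. The theorem below shows that the
shape "a strict-slide invariant separating some R-link from every `0`-framed unlink", with the
invariant's codomain and values UNCONSTRAINED, is logically equivalent to the crux (the `←`
direction takes for the invariant the slide class itself). Consequences for the line, recorded
for the lead and the planners:

* The skeleton carries content only through the NAMING of `H = u_q(sl₂)` (or another finite-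
  dimensional unimodular ribbon Hopf algebra), of the receptacle `Q_n(H)` and of `J` (universal
  invariant of an opening) — i.e. through stub K3 (functoriality over the tree's
  `StrictHandleSlideMove`, definition-sized) and the COMPUTABILITY of `[J_T]`. A K2 "certificate"
  produced by any procedure that is not provably a function of the strict-slide class is, by this
  theorem, worth exactly as much as an unproved assertion of the crux.
* K1 as "dim W > number of Kirby-type functionals" is NECESSARY but carries no separation by
  itself: an excess functional may be constant on the image `{J_T}`. Toy model (checked
  numerically for `m ≤ 40` in this seat's folder, and on paper by transitivity of `SL₂(ℤ/m)` on
  vectors of given order): for the commutative cocommutative `H = k[ℤ/m]` with trivial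
  `R`-matrix the two-component receptacle dual (functions on `(ℤ/m)²` invariant under both slides
  `(a,b) ↦ (a+b,b)`, `(a,b) ↦ (a,a+b)`; ad-invariance and braidings are vacuous) is the space of
  `SL₂(ℤ)`-invariant functions on `(ℤ/m)²`, of dimension `τ(m)` (number of divisors: 3, 4, 4, 6,
  8, 9 for `m` = 4, 6, 8, 12, 30, 36), spanned by the indicators of `S × S` for the subgroups `S`
  — all of Kirby type (integral functionals of Hopf subalgebras) — while `J_T = 1 ⊗ 1` for every
  `T`; so "no excess, no separation" there, and any excess for `u_q(sl₂)` is a genuinely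
  non-(co)commutative effect that must still be tested ON THE IMAGE (the card's own refined K1:
  "restricted to the span of universal invariants of algebraically split 0-framed bottom
  tangles").
* Structure of the one-sided slide equation, for ANY finite-dimensional Hopf algebra `H` with a
  left integral functional `λ` (`y₁ λ(y₂) = λ(y) 1`) and a left integral element `Λ`
  (`y Λ = ε(y) Λ`), ordinary coproduct, `h = (μ ⊗ 1)(1 ⊗ Δ)`: writing (Frobenius) every
  `F ∈ (H ⊗ H)*` uniquely as `F(x ⊗ y) = λ(x · φ(y))` with `φ ∈ End_k(H)`, the condition
  `F ∘ h = F`, i.e. `F(x y₁ ⊗ y₂) = F(x ⊗ y)`, is EQUIVALENT to the fixed-point equation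
  `y₁ · φ(y₂) = φ(y)` for all `y` (nondegeneracy of `λ`). Two families of solutions exist for
  every `H`: `φ(y) = g(y) Λ` (`g ∈ H*`; these are `F = λ(Λ)·ε ⊗ g`) and `φ(y) = λ(y) a`
  (`a ∈ H`; these are `F = f_a ⊗ λ` with `f_a = λ(· a)`), meeting in the line of `λ ⊗ λ`; so
  `dim W₀ ≥ 2 dim H − 1` before ad-invariance, and the two-sided slide condition cuts the span
  of these two families down to `span{ε ⊗ ε, λ ⊗ λ}` (because `λ ⊗ f` is `h`-invariant iff `f`
  is a left integral). Everything in `W` beyond that plane comes from fixed points of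
  `φ ↦ (y ↦ y₁ φ(y₂))` outside the two families (for `k[G]` the fixed points are indexed by the
  orbits of `(g, h) ↦ (gh, h)` on `G × G`, i.e. by pairs (right coset of `⟨h⟩`, `h`), so
  `dim W₀ = Σ_{h ∈ G} [G : ⟨h⟩]`, which exceeds `2|G| - 1` as soon as `G` has an element of
  order strictly between `1` and `|G|`). The lead's `dim W`
  count for `u_q(sl₂)` should reproduce the plane `span{ε ⊗ ε, λ ⊗ λ}` as a sanity check and
  report the excess as explicit fixed points `φ`.
* A cheap adversarial test for K2 ON POOL A (stably slide-trivial links `L(3,2;4/d)`): the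
  universal invariant is multiplicative under split union, `J_{T ⊔ O} = J_T ⊗ 1`, and Pool A
  links satisfy `L ⊔ Oᵏ ~ U_{n+k}` by strict slides (DPY 2026 Thm 1.1; the 3-handles are never
  seen by the receptacle), so `G(J_T ⊗ 1^{⊗k}) = G(1^{⊗(n+k)})` for EVERY slide-invariant `G` on
  `n + k` slots. Consequently a slide-invariant functional `F` on `n` slots can separate a Pool-A
  link from the unlink ONLY IF `F ⊗ ε^{⊗k}` is NOT slide-invariant on `n + k` slots. Checking the
  generators: slides among the first `n` slots, slides of a new slot over an old one, braidings
  with and re-embeddings of the new slots are all respected by `F ⊗ ε^{⊗k}` automatically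
  (`(ε ⊗ id) R = 1`, `ε ∘ ad_z = ε(z) ε`); the ONLY generator that can fail is the slide of an old
  slot `j` over a new one, which requires right-`ε`-linearity `F(… ⊗ x·y ⊗ …) = ε(y) F(… ⊗ x ⊗ …)`
  in slot `j` (for `y` ranging over the last-slot components of the image). So: every exotic
  functional found by K1-refined that is right-`ε`-linear in each slot on the image is BLIND on
  all of Pool A; only exotics failing right-`ε`-linearity can see Pool A (the Hennings functional
  `χ ⊗ χ` fails it — `χ(y) ≠ ε(y) χ(1) = 0` — but is blind for the usual 3-manifold reason). This
  is a finite linear test on the models the lead already has; Pool B (GST `L_n`, trivialised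
  only through 1/2 Hopf pairs) is not touched by it. Recommended before any K2 evaluation on
  Pool A.
* Route interaction (from p150066, imported above): every link in the card's Pools A/B has
  `Σ_L ≅ S⁴`, hence smoothly slice components; a certificate there closes this crux AND refutes
  the sibling crux `VrlSliceRigidity` (`VrlSliceRigidity_false_of_acNontrivial`-type collision),
  so the route would need its intended bridge `VrlSkeinBlindOnSphere` re-glued first. -/

/-- **"There is a strict-slide invariant separating some R-link from every `0`-framed unlink" IS
the crux.** `→`: an invariant of the generating moves is an invariant of the generated
equivalence (`Relation.EqvGen` induction), so a value difference forbids equivalence. `←`: take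
`M := Prop` and `σ X :=` "`X` is strictly slide-equivalent to some `0`-framed unlink with the same
number of components"; `σ` is move-invariant (moves preserve the component count and the class),
true on every `0`-framed unlink (reflexivity) and false on the crux's witness. Hence any
skeleton of the shape `functoriality ∧ certificate → crux` with an UNNAMED invariant is a
restatement; content enters only with a named, computable `σ`. [folklore] -/
theorem invariantShape_iff_vrlSlideGap :
    (∃ (M : Type) (σ : FramedLinkFin → M),
      (∀ L L' : FramedLinkFin, StrictHandleSlideMove L L' → σ L = σ L') ∧
      ∃ (_ : Knot.TubularNbhd.SmoothnessFacts) (n : ℕ) (L : FramedLink (Fin n)) (Y : Type)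
        (_ : TopologicalSpace Y) (_ : T2Space Y) (_ : SecondCountableTopology Y)
        (_ : ChartedSpace (𝔼 3) Y) (_ : IsManifold (𝓡 3) ∞ Y) (_ : CompactSpace Y)
        (_ : ConnectedSpace Y),
        IsSphereTwoProdCircleSum n Y ∧ L.IsSurgery (𝓡 3) Y ∧
          ∀ U : FramedLink (Fin n), U.IsZeroFramedUnlink → σ ⟨n, L⟩ ≠ σ ⟨n, U⟩) ↔
    VrlSlideGap := by
  constructor
  · rintro ⟨M, σ, hσ, inst, n, L, Y, i1, i2, i3, i4, i5, i6, i7, hY, hL, hsep⟩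
    exact ⟨inst, n, L, Y, i1, i2, i3, i4, i5, i6, i7, hY, hL, fun U hU hLU ↦
      hsep U hU (invariant_of_equiv σ hσ hLU)⟩
  · rintro ⟨inst, n, L, Y, i1, i2, i3, i4, i5, i6, i7, hY, hL, hgap⟩
    -- the invariant: "slides to some `0`-framed unlink with the same number of components"
    let σ : FramedLinkFin → Prop := fun X ↦
      ∃ U : FramedLink (Fin X.1), U.IsZeroFramedUnlink ∧ IsStrictHandleSlideEquivalent X ⟨X.1, U⟩
    have hmove : ∀ X X' : FramedLinkFin, StrictHandleSlideMove X X' → X.1 = X'.1 := by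
      intro X X' h
      cases h <;> rfl
    have hσ : ∀ X X' : FramedLinkFin, StrictHandleSlideMove X X' → σ X = σ X' := by
      intro X X' h
      have h1 := hmove X X' h
      obtain ⟨k, A⟩ := X
      obtain ⟨k', A'⟩ := X'
      dsimp only at h1
      subst h1
      apply propext
      constructor
      · rintro ⟨U, hU, hAU⟩
        exact ⟨U, hU, (Relation.EqvGen.symm _ _ (Relation.EqvGen.rel _ _ h)).trans _ _ _ hAU⟩
      · rintro ⟨U, hU, hAU⟩
        exact ⟨U, hU, (Relation.EqvGen.rel _ _ h).trans _ _ _ hAU⟩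
    refine ⟨Prop, σ, hσ, inst, n, L, Y, i1, i2, i3, i4, i5, i6, i7, hY, hL, fun U hU hLU ↦ ?_⟩
    have hσU : σ ⟨n, U⟩ := ⟨U, hU, Relation.EqvGen.refl _⟩
    have hσL : ¬ σ ⟨n, L⟩ := fun ⟨U', hU', hLU'⟩ ↦ hgap U' hU' hLU'
    exact hσL (hLU ▸ hσU)

/-! ## §4b The lead's exact skeleton shapes (`Lines/Sketch.lean`, verbatim copies) are a restatement

`Lines/Sketch.lean` (lead, 2026-08-17T11:58Z) is a crux work file and not an importable module, so
its two parametric shapes are COPIED VERBATIM here (namespace `SketchCopy`) together with a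
three-line re-proof of its glue `vrlSlideGap_of`; `sketchShape_iff_vrlSlideGap` then shows that
"`∃ (M, N, J)`, `Functorial N J ∧ Certificate N J`" is logically the crux (take `M = ℤ`, `N = ⊥`,
`J` = indicator of "slides to a `0`-framed unlink"). This is the kernel-checked form of the lead's
own remark "with `(M, N, J)` existentially quantified the two statements conjoin to the crux
itself"; it is why `ledger skeleton check` answers `skeleton.extra-hypothesis`, and why the line's
content is entirely in K1/K2 (computations naming `H = u_q(sl₂)`) and D1 (the diagrammatic
carrier naming `J`). STATUS OF K1 recorded from the lead's `Cruxes/VrlSlideGap/NOTES.md`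
(2026-08-17): coarse receptacle for `u_q(sl₂)`, `p = 3, 5, 7`: `W = span{ε ⊗ ε, χ ⊗ χ}` EXACTLY —
the plane predicted in §4 for every finite-dimensional Hopf algebra and nothing else — hence
blind on R-links at the coarse level; the zero-linking refinement (Habiro Remark 16) at `p = 5`
is the remaining life test (kit job j025960). -/

namespace SketchCopy

variable {M : Type*} [AddCommGroup M] (N : AddSubgroup M) (J : FramedLinkFin → M)

/-- VERBATIM COPY of `Lines/Sketch.lean`'s `Functorial` (card K3, shape): `J` changes by an
element of `N` under every generating move. -/
def Functorial : Prop :=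
  ∀ L L' : FramedLinkFin, StrictHandleSlideMove L L' → J L' - J L ∈ N

/-- VERBATIM COPY of `Lines/Sketch.lean`'s `Certificate` (card K2, shape): some R-link whose class
in `M ⧸ N` differs from the class of every `0`-framed unlink. -/
def Certificate : Prop :=
  ∃ (n : ℕ) (L : FramedLink (Fin n)) (Y : Type) (_ : TopologicalSpace Y) (_ : T2Space Y)
    (_ : SecondCountableTopology Y) (_ : ChartedSpace (EuclideanSpace ℝ (Fin 3)) Y)
    (_ : IsManifold (𝓡 3) ((⊤ : ℕ∞) : WithTop ℕ∞) Y) (_ : CompactSpace Y) (_ : ConnectedSpace Y),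
    IsSphereTwoProdCircleSum n Y ∧ L.IsSurgery (𝓡 3) Y ∧
      ∀ U : FramedLink (Fin n), U.IsZeroFramedUnlink →
        (QuotientAddGroup.mk (J ⟨n, L⟩) : M ⧸ N) ≠ QuotientAddGroup.mk (J ⟨n, U⟩)

/-- Re-proof of the lead's glue `vrlSlideGap_of` (functoriality + certificate ⇒ crux), via
`invariant_of_equiv` applied to the class map. [folklore] -/
theorem vrlSlideGap_of (hJ : Functorial N J) (hC : Certificate N J) : VrlSlideGap := by
  obtain ⟨n, L, Y, i₁, i₂, i₃, i₄, i₅, i₆, i₇, hY, hL, hgap⟩ := hC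
  refine ⟨inferInstance, n, L, Y, i₁, i₂, i₃, i₄, i₅, i₆, i₇, hY, hL, fun U hU hLU ↦ hgap U hU ?_⟩
  refine invariant_of_equiv (fun X ↦ (QuotientAddGroup.mk (J X) : M ⧸ N)) (fun X X' h ↦ ?_) hLU
  rw [QuotientAddGroup.eq, ← sub_eq_neg_add]
  exact hJ X X' h

/-- **Converse: the crux yields `(ℤ, ⊥, J)` with `Functorial ∧ Certificate`** — `J` the indicator
of "slides to some `0`-framed unlink with the same number of components". [folklore] -/
theorem exists_functorial_certificate_of_vrlSlideGap (hg : VrlSlideGap) :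
    ∃ J : FramedLinkFin → ℤ, Functorial (⊥ : AddSubgroup ℤ) J ∧ Certificate (⊥ : AddSubgroup ℤ) J := by
  classical
  obtain ⟨inst, n, L, Y, i1, i2, i3, i4, i5, i6, i7, hY, hL, hgap⟩ := hg
  let σ : FramedLinkFin → Prop := fun X ↦
    ∃ U : FramedLink (Fin X.1), U.IsZeroFramedUnlink ∧ IsStrictHandleSlideEquivalent X ⟨X.1, U⟩
  have hmove : ∀ X X' : FramedLinkFin, StrictHandleSlideMove X X' → X.1 = X'.1 := by
    intro X X' h
    cases h <;> rfl
  have hσ : ∀ X X' : FramedLinkFin, StrictHandleSlideMove X X' → (σ X ↔ σ X') := by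
    intro X X' h
    have h1 := hmove X X' h
    obtain ⟨k, A⟩ := X
    obtain ⟨k', A'⟩ := X'
    dsimp only at h1
    subst h1
    constructor
    · rintro ⟨U, hU, hAU⟩
      exact ⟨U, hU, (Relation.EqvGen.symm _ _ (Relation.EqvGen.rel _ _ h)).trans _ _ _ hAU⟩
    · rintro ⟨U, hU, hAU⟩
      exact ⟨U, hU, (Relation.EqvGen.rel _ _ h).trans _ _ _ hAU⟩
  let J : FramedLinkFin → ℤ := fun X ↦ if σ X then 1 else 0
  refine ⟨J, fun X X' h ↦ ?_, n, L, Y, i1, i2, i3, i4, i5, i6, i7, hY, hL, fun U hU hLU ↦ ?_⟩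
  · have : J X' = J X := by
      simp only [J, hσ X X' h]
    simp [this]
  · have hσU : σ ⟨n, U⟩ := ⟨U, hU, Relation.EqvGen.refl _⟩
    have hσL : ¬ σ ⟨n, L⟩ := fun ⟨U', hU', hLU'⟩ ↦ hgap U' hU' hLU'
    rw [QuotientAddGroup.eq, AddSubgroup.mem_bot] at hLU
    simp only [J, if_pos hσU, if_neg hσL] at hLU
    omega

/-- **The lead's parametric skeleton is a restatement of the crux** until `(M, N, J)` are named:
`(∃ M N J, Functorial N J ∧ Certificate N J) ↔ VrlSlideGap`. [folklore] -/
theorem sketchShape_iff_vrlSlideGap :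
    (∃ (M : Type) (_ : AddCommGroup M) (N : AddSubgroup M) (J : FramedLinkFin → M),
      Functorial N J ∧ Certificate N J) ↔ VrlSlideGap :=
  ⟨fun ⟨_, _, N, J, hF, hC⟩ ↦ vrlSlideGap_of N J hF hC,
    fun hg ↦ let ⟨J, hF, hC⟩ := exists_functorial_certificate_of_vrlSlideGap hg
      ⟨ℤ, inferInstance, ⊥, J, hF, hC⟩⟩

end SketchCopy

/-! ## §5 Witness-pool constraints in print (not typable cheaply; guidance for provers)

A witness `(n, L, Y)` of the crux must satisfy, in print:
* `n ≥ 2` (`two_le_of_witness`; Gabai 1987);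
* all framings `0` and all linking numbers `0` (GST 2010 Prop. 2.2: `H₁(#ⁿ S²×S¹) = ℤⁿ` is the
  cokernel of the linking matrix) — so strict slides stay inside algebraically split `0`-framed
  links, and the framing bookkeeping `nᵢ + nⱼ ± 2·lk` of `IsStrictHandleSlide` is identically `0`
  along any slide path starting at an R-link;
* every component is slice in a homotopy 4-ball (Hillman, GST Prop. 2.3; = route item
  VrlComponentsHBallSlice), hence topologically slice (Freedman); a component NOT smoothly slice in
  `B⁴` makes `Σ_L` exotic (FGMW, the route's `closes`);
* at `n = 2`: neither component is the unknot (GST Prop. 3.2, "the unknot has Property 2R" —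
  its proof USES slides over the unknotted component), the tunnel number of `L` is not `1`
  (Reid, GST Prop. 3.1: then `L` is the unlink), and a least-genus counterexample component is
  not fibred (GST Thm 3.3; trefoil and figure-eight have Property 2R for being non-slice);
* stably (one distant `0`-framed unknot allowed) every `c`-component R-link of tunnel number `c`
  slides (Meier–Schirmer–Zupan 2016 Thm 1.1/Cor. 1.3) — irrelevant to the UNSTABLE crux except as
  a hint that low tunnel number is the wrong place to look;
* the standing candidates: GST `L_{n,1} = Q ⊔ Vₙ`, `n ≥ 3` (square knot `Q`; AC-suspicious
  presentations `AK(n)`), Meier–Zupan's generalized-square-knot families (even `n`), and the 2026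
  pool `L(3,2;4/d)`, `5 ≤ d ≤ 39` (Diao–Pan–Yan arXiv:2604.17737 Thm 1.1: STABLY slide-trivial,
  Romary–Zupan 2024: AC-trivial presentations; unstable status open — LOSZ arXiv:2603.05664 Q1.7).
Literature status re-checked 2026-08-17 (arXiv live; local searchd reset): no proof or disproof
of GPRC; AK(3) stable AC-triviality claim (Shehper et al. v1, re-derived by Lisitsa
arXiv:2501.18601) withdrawn in Shehper et al. v2 (tree docstring of `AndrewsCurtisConjecture`);
Carreras arXiv:2607.23611 (July 2026): AC frontier certificates at relator length 14, AK(3) open.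

## §6 Why no junk refutation exists (interface audit, cycle 1)

To refute an `∃`-statement cheaply one needs its data conjuncts UNSATISFIABLE or its last clause
TRIVIALLY FALSE. Neither happens:
* `IsSurgery` = `IsIntegralSurgeryLink`: honest open gluing of `S³ ∖ L` with `n` open solid tori
  along the polar identification `ν (u, t•v) ∼ (t•u, v)`; INHABITED with all seven instance
  binders for every `0`-framed unlink (`exists_isSurgery_zeroFramedUnlink_holds`, proved).
* `IsSphereTwoProdCircleSum`: recursion over Kervaire–Milnor's connected-sum relation
  (`IsConnectedSum`, inversion `t•u ↦ (1-t)•u` on punctured unit balls); inhabited (same theorem).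
* `IsStrictHandleSlideEquivalent` = `EqvGen` of {ambient isotopy (`AmbientIsotopy`: jointly
  smooth, `F 0 = id`), renumbering, reversal, strict slide}; the strict slide's framing change
  `nᵢ + nⱼ + 2l` is single-valued because `HasLinkingNumber` is unique
  (`existsUnique_hasLinkingNumber_holds`); the band misses the other components AND the collar
  annulus, so the move is the printed one. Trivial falsity of the no-slide clause for ALL R-links
  would be printed GPRC. At `n = 1` the relation is provably rigid (`framing_eq_of_equiv_one`).
* The two Prop-classes have proved global instances; `Y : Type` (universe 0) matches the
  Literature conjecture verbatim (`vrlSlideGap_iff_not_strictGPRC` type-checks with no universe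
  bookkeeping).
So the crux is neither vacuous nor trivially false; it is printed `¬GPRC`, full stop.
-/

end Summit.SmoothPoincare4.SmoothPoincare4.Cruxes.VrlSlideGap.Disproof

end
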